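import Summits.Ventures.WeilGRH.DualTrigKernelSoundB
import Summits.Ventures.WeilGRH.DualTrigKernelDigamma
import HarnessLib

/-!
# Format D-K soundness, part 5: the digamma data of a cell and the cell theorem

Cell `rh-explicit`, WEIL TRACK — GRH ARM, route B (weil-grh-3).  Continuation of
`DualTrigKernelSoundB.lean`.  With `ρ = D/(2 log p₀)` (so `y = τ/2 = ρθ`), `σ' = 1/4 + a/2`:

* `digammaData_sound` — on the cell `θ ∈ [2πj/Mc, 2π(j+1)/Mc]`, with `φ = θ − θ_c`,
  `Re ψ(σ' + iρθ) ≥ BR.lo/S + F₀ + F₁ φ − EF.hi/S` for reals `F₀ ∈ F0`, `F₁ ∈ F1`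
  (bracket monotonicity + first-order expansion of the `M₀` leading series terms);
* `cellLo_sound` — if `cellLo b ts E j = some (lo, loT)` then on that cell the full function is `≥ lo/S`
  and the periodic part is `≥ loT/S`.

Everything here is PROVED; no named facts, no `sorry`.
-/

noncomputable section

open Finset Real Complex

namespace Summit.Ventures.WeilGRH

open Literature.Analysis.ValidatedNumerics.NumericsMP
open DualTrigTaylor DigammaVertical

namespace DKCert

variable {c : DKCert}

/-- The real `σ' = (1 + 2a)/4`. [folklore] -/
def sigR (c : DKCert) : ℝ := (1 + 2 * (c.par : ℝ)) / 4

/-- `σ' ∈ sigI` and `σ' > 0`. [folklore] -/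
theorem sigR_mem : MI.mem c.S c.sigR c.sigI ∧ 0 < c.sigR := by
  refine ⟨?_, by unfold sigR; positivity⟩
  have := MI.mem_ofFrac c.S (1 + 2 * (c.par : ℤ)) (q := 4) (by norm_num)
  unfold sigR sigI
  convert this using 1; push_cast; ring

/-- `l_m = m + σ' ∈ lI m`, and `l_m > 0`. [folklore] -/
theorem lI_mem (m : ℕ) : MI.mem c.S ((m : ℝ) + c.sigR) (c.lI m) ∧ 0 < (m : ℝ) + c.sigR := by
  refine ⟨?_, by have := (sigR_mem (c := c)).2; positivity⟩
  have := MI.mem_ofFrac c.S (4 * (m : ℤ) + 1 + 2 * c.par) (q := 4) (by norm_num)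
  unfold lI sigR
  convert this using 1; push_cast; ring

/-- `fTerm` encloses `f_l(y)`. [folklore] -/
theorem fTerm_mem (hS : 0 < c.S) {l y : ℝ} {L Y F : MI} (hL : MI.mem c.S l L) (hY : MI.mem c.S y Y)
    (h : c.fTerm L Y = some F) : MI.mem c.S (vterm l y) F := by
  unfold fTerm at h
  have := MI.mem_divPos hS h (MI.mem_sqr hS hY)
    (MI.mem_mul hS hL (MI.mem_add (MI.mem_sqr hS hL) (MI.mem_sqr hS hY)))
  unfold vterm; exact this

/-- `fDeriv` encloses `f_l'(c)`. [folklore] -/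
theorem fDeriv_mem (hS : 0 < c.S) {l y : ℝ} {L Y F : MI} (hL : MI.mem c.S l L) (hY : MI.mem c.S y Y)
    (h : c.fDeriv L Y = some F) : MI.mem c.S (vtermD l y) F := by
  unfold fDeriv at h
  have hnum : MI.mem c.S (2 * l * y) ((MI.mul c.S L Y).mulInt 2) := by
    have := MI.mem_mulInt (MI.mem_mul hS hL hY) 2; push_cast at this; convert this using 1; ring
  have := MI.mem_divPos hS h hnum (MI.mem_sqr hS (MI.mem_add (MI.mem_sqr hS hL) (MI.mem_sqr hS hY)))
  unfold vtermD; exact this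

/-- `fRem` encloses `(l² + c² + 2 C Ym)/(l(l²+c²)²)` with `C = absHi(Y)/S ≥ |c|`. [folklore] -/
theorem fRem_mem (hS : 0 < c.S) {l yc ym : ℝ} {L Y YM F : MI} (hL : MI.mem c.S l L)
    (hY : MI.mem c.S yc Y) (hYM : MI.mem c.S ym YM) (h : c.fRem L Y YM = some F) :
    MI.mem c.S ((l ^ 2 + yc ^ 2 + 2 * ((Y.absHi : ℝ) / c.S) * ym) / (l * (l ^ 2 + yc ^ 2) ^ 2)) F := by
  unfold fRem at h
  have hnum : MI.mem c.S (l ^ 2 + yc ^ 2 + 2 * ((Y.absHi : ℝ) / c.S) * ym)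
      (((L.sqr c.S).add (Y.sqr c.S)).add ((MI.mul c.S (absUp Y) YM).mulInt 2)) := by
    have h1 := MI.mem_mulInt (MI.mem_mul hS (mem_absUp hS Y) hYM) 2
    have := MI.mem_add (MI.mem_add (MI.mem_sqr hS hL) (MI.mem_sqr hS hY)) h1
    convert this using 1; push_cast; ring
  exact MI.mem_divPos hS h hnum (MI.mem_mul hS hL (MI.mem_sqr hS (MI.mem_add (MI.mem_sqr hS hL)
    (MI.mem_sqr hS hY))))

/-- `sumOpt` encloses the finite sum. [folklore] -/
theorem sumOpt_mem {f : ℕ → Option MI} {g : ℕ → ℝ} (hfg : ∀ m, ∀ F, f m = some F → MI.mem c.S (g m) F) :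
    ∀ (M : ℕ) {s : MI}, c.sumOpt f M = some s → MI.mem c.S (∑ m ∈ range M, g m) s
  | 0, s, h => by
      simp only [sumOpt, Option.some.injEq] at h; subst h; simpa using MI.mem_ofInt c.S 0
  | M + 1, s, h => by
      simp only [sumOpt] at h
      cases hrec : c.sumOpt f M with
      | none => simp [hrec] at h
      | some s' =>
        cases hF : f M with
        | none => simp [hrec, hF] at h
        | some F =>
          simp only [hrec, hF, Option.some.injEq] at h; subst h
          rw [Finset.sum_range_succ]
          exact MI.mem_add (sumOpt_mem hfg M hrec) (hfg M F hF)

/-! ### The digamma data of a cell -/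

set_option maxHeartbeats 400000 in
/-- The real frequency-to-height factor `ρ = D/(2 log p₀)` and its basic membership are ASSUMED here as
hypotheses on a real `ρ > 0` with `ρ ∈ rhoI`; likewise `π ∈ piI`. The conclusion of `digammaData`. [folklore] -/
theorem digammaData_sound (hS : 0 < c.S) (hpi : MI.mem c.S Real.pi c.piI) {ρ : ℝ} (hρ : 0 < ρ)
    (hrho : MI.mem c.S ρ c.rhoI) {b : DKBlock} (hMc : 1 ≤ b.Mc) (hden : 1 ≤ b.etaDen) (j : ℤ)
    {BR F0 F1 EF : MI} (h : c.digammaData b j = some (BR, F0, F1, EF)) :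
    ∃ F0r F1r : ℝ, MI.mem c.S F0r F0 ∧ MI.mem c.S F1r F1 ∧ BR.hi = BR.lo ∧
      ∀ θ : ℝ, 2 * π * j / b.Mc ≤ θ → θ ≤ 2 * π * (j + 1) / b.Mc →
        |θ - (2 * j + 1) * π / b.Mc| ≤ (b.etaNum : ℝ) / b.etaDen →
        ((BR.lo : ℝ) / c.S) + F0r + F1r * (θ - (2 * j + 1) * π / b.Mc) - (EF.hi : ℝ) / c.S ≤
          (Complex.digamma ((c.sigR : ℂ) + (ρ * θ : ℝ) * I)).re := by
  have hSr : (0 : ℝ) < c.S := by exact_mod_cast hS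
  have hMcr : (0 : ℝ) < b.Mc := by exact_mod_cast hMc
  obtain ⟨hsig, hsig0⟩ := sigR_mem (c := c)
  -- name the intermediate quantities exactly as in the definition
  set thLo := (c.piI.mulInt (2 * j)).divNat b.Mc with hthLo
  set thHi := (c.piI.mulInt (2 * j + 2)).divNat b.Mc with hthHi
  set thC := (c.piI.mulInt (2 * j + 1)).divNat b.Mc with hthC
  set yLo := MI.mul c.S thLo c.rhoI with hyLo
  set yHi := MI.mul c.S thHi c.rhoI with hyHi
  set yC := MI.mul c.S thC c.rhoI with hyC
  set ytil : ℤ := if 0 ≤ yLo.lo then yLo.lo else if yHi.hi ≤ 0 then -yHi.hi else 0 with hytil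
  set ytI : MI := ⟨ytil, ytil⟩ with hytI
  set etaI := MI.ofFrac c.S b.etaNum b.etaDen with hetaI
  set reta := MI.mul c.S c.rhoI etaI with hreta
  set Ymax := (absUp yC).add reta with hYmax
  unfold digammaData at h
  simp only [← hthLo, ← hthHi, ← hthC, ← hyLo, ← hyHi, ← hyC, ← hytil, ← hytI, ← hetaI, ← hreta, ← hYmax] at h
  -- real counterparts
  set θc : ℝ := (2 * j + 1) * π / b.Mc with hθc
  set yc : ℝ := θc * ρ with hyc
  set ηr : ℝ := (b.etaNum : ℝ) / b.etaDen with hηr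
  have hθC : MI.mem c.S θc thC := by
    have := MI.mem_divNat (MI.mem_mulInt hpi (2 * j + 1)) (n := b.Mc) (by omega)
    rw [hθc]; convert this using 1; push_cast; ring
  have hyCm : MI.mem c.S yc yC := MI.mem_mul hS hθC hrho
  have hyt : MI.mem c.S ((ytil : ℝ) / c.S) ytI := mem_thin hS ytil
  have hηm : MI.mem c.S ηr etaI := by
    have := MI.mem_ofFrac c.S (b.etaNum : ℤ) (q := b.etaDen) (by omega)
    rw [hηr, hetaI]; convert this using 2; norm_cast
  have hretam : MI.mem c.S (ρ * ηr) reta := MI.mem_mul hS hrho hηm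
  set YM : ℝ := (yC.absHi : ℝ) / c.S + ρ * ηr with hYM
  have hYMm : MI.mem c.S YM Ymax := MI.mem_add (mem_absUp hS yC) hretam
  have hYM0 : 0 ≤ YM := by
    have h1 : 0 ≤ (yC.absHi : ℝ) / c.S := le_trans (abs_nonneg _) (abs_le_absUp hS hyCm)
    have h2 : 0 ≤ ηr := by rw [hηr]; positivity
    rw [hYM]; positivity
  -- unpack the five options
  cases hDg : MC.digammaBox c.S c.Kdig c.Jdig c.piI MC.bernoulliTable ⟨c.sigI, ytI⟩ with
  | none => simp [hDg] at h
  | some Dg =>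
  cases hFt : c.sumOpt (fun m ↦ c.fTerm (c.lI m) ytI) c.M0 with
  | none => simp [hFt] at h
  | some Ft =>
  cases hF0 : c.sumOpt (fun m ↦ c.fTerm (c.lI m) yC) c.M0 with
  | none => simp [hF0] at h
  | some F0' =>
  cases hF1 : c.sumOpt (fun m ↦ c.fDeriv (c.lI m) yC) c.M0 with
  | none => simp [hF1] at h
  | some F1' =>
  cases hF2 : c.sumOpt (fun m ↦ c.fRem (c.lI m) yC Ymax) c.M0 with
  | none => simp [hF2] at h
  | some F2' =>
  simp only [hDg, hFt, hF0, hF1, hF2, Option.some.injEq, Prod.mk.injEq] at h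
  obtain ⟨hBR, hF0e, hF1e, hEFe⟩ := h
  -- the real sums
  set F0r : ℝ := ∑ m ∈ range c.M0, vterm ((m : ℝ) + c.sigR) yc
  set F1s : ℝ := ∑ m ∈ range c.M0, vtermD ((m : ℝ) + c.sigR) yc
  set Rs : ℝ := ∑ m ∈ range c.M0,
    (((m : ℝ) + c.sigR) ^ 2 + yc ^ 2 + 2 * ((yC.absHi : ℝ) / c.S) * YM) /
      (((m : ℝ) + c.sigR) * (((m : ℝ) + c.sigR) ^ 2 + yc ^ 2) ^ 2)
  have hF0m : MI.mem c.S F0r F0' :=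
    sumOpt_mem (fun m F hF ↦ fTerm_mem hS (lI_mem m).1 hyCm hF) c.M0 hF0
  have hF1m : MI.mem c.S F1s F1' :=
    sumOpt_mem (fun m F hF ↦ fDeriv_mem hS (lI_mem m).1 hyCm hF) c.M0 hF1
  have hRsm : MI.mem c.S Rs F2' :=
    sumOpt_mem (fun m F hF ↦ fRem_mem hS (lI_mem m).1 hyCm hYMm hF) c.M0 hF2
  have hFtm : MI.mem c.S (∑ m ∈ range c.M0, vterm ((m : ℝ) + c.sigR) ((ytil : ℝ) / c.S)) Ft :=
    sumOpt_mem (fun m F hF ↦ fTerm_mem hS (lI_mem m).1 hyt hF) c.M0 hFt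
  refine ⟨F0r, ρ * F1s, hF0e ▸ hF0m, hF1e ▸ MI.mem_mul hS hrho hF1m, by rw [← hBR], ?_⟩
  intro θ hθ1 hθ2 hφ
  set φ := θ - θc with hφdef
  set y : ℝ := ρ * θ with hy
  have hyφ : y = yc + φ * ρ := by rw [hy, hyc, hφdef]; ring
  -- (a) the bracket
  have hyt_le : |((ytil : ℝ) / c.S)| ≤ |y| := by
    have hyLom : MI.mem c.S (2 * π * j / b.Mc * ρ) yLo := by
      have := MI.mem_divNat (MI.mem_mulInt hpi (2 * j)) (n := b.Mc) (by omega)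
      refine MI.mem_mul hS ?_ hrho
      convert this using 1; push_cast; ring
    have hyHim : MI.mem c.S (2 * π * (j + 1) / b.Mc * ρ) yHi := by
      have := MI.mem_divNat (MI.mem_mulInt hpi (2 * j + 2)) (n := b.Mc) (by omega)
      refine MI.mem_mul hS ?_ hrho
      convert this using 1; push_cast; ring
    have hlo : (yLo.lo : ℝ) / c.S ≤ y := (lo_le hS hyLom).trans (by rw [hy]; nlinarith)
    have hhi : y ≤ (yHi.hi : ℝ) / c.S := le_trans (by rw [hy]; nlinarith) (le_hi hS hyHim)
    rw [hytil]
    split_ifs with h1 h2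
    · have h1' : (0 : ℝ) ≤ yLo.lo := by exact_mod_cast h1
      rw [abs_of_nonneg (by positivity)]
      exact le_trans hlo (le_abs_self y)
    · have h2' : (yHi.hi : ℝ) ≤ 0 := by exact_mod_cast h2
      have : ((-yHi.hi : ℤ) : ℝ) / c.S = -((yHi.hi : ℝ) / c.S) := by push_cast; ring
      rw [this, abs_of_nonneg (by rw [neg_nonneg]; exact div_nonpos_of_nonpos_of_nonneg h2' hSr.le)]
      have : y ≤ 0 := hhi.trans (div_nonpos_of_nonpos_of_nonneg h2' hSr.le)
      rw [abs_of_nonpos this]; linarith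
    · simp
  have hbr : ((Dg.re.sub Ft).lo : ℝ) / c.S ≤ bracket c.sigR c.M0 y := by
    have hmono := bracket_mono hsig0 c.M0 hyt_le
    refine le_trans ?_ hmono
    have hw : MC.mem c.S ((c.sigR : ℂ) + (((ytil : ℝ) / c.S : ℝ) : ℂ) * I) ⟨c.sigI, ytI⟩ := by
      refine ⟨?_, ?_⟩
      · simp only [Complex.add_re, Complex.ofReal_re, Complex.mul_re, Complex.I_re, Complex.I_im,
          Complex.ofReal_im, mul_zero, mul_one, sub_zero, add_zero]
        exact hsig
      · simp only [Complex.add_im, Complex.ofReal_im, Complex.mul_im, Complex.I_re, Complex.I_im,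
          Complex.ofReal_re, mul_zero, mul_one, zero_add, add_zero]
        exact hyt
    have hdig := MC.mem_digammaBox_table hS hpi hDg hw
    exact lo_le hS (MI.mem_sub hdig.1 hFtm)
  -- (b) the explicit terms
  have habsy : |y| ≤ YM := by
    rw [hyφ, hYM]
    calc |yc + φ * ρ| ≤ |yc| + |φ * ρ| := abs_add_le _ _
      _ ≤ (yC.absHi : ℝ) / c.S + ρ * ηr := by
          gcongr
          · exact abs_le_absUp hS hyCm
          · rw [abs_mul, abs_of_pos hρ, mul_comm]; gcongr
  have hterms : F0r + ρ * F1s * φ - (φ * ρ) ^ 2 * Rs ≤ ∑ m ∈ range c.M0, vterm ((m : ℝ) + c.sigR) y := by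
    have : ∀ m ∈ range c.M0, vterm ((m : ℝ) + c.sigR) yc + vtermD ((m : ℝ) + c.sigR) yc * (y - yc) -
        (y - yc) ^ 2 * ((((m : ℝ) + c.sigR) ^ 2 + yc ^ 2 + 2 * ((yC.absHi : ℝ) / c.S) * YM) /
          (((m : ℝ) + c.sigR) * (((m : ℝ) + c.sigR) ^ 2 + yc ^ 2) ^ 2)) ≤ vterm ((m : ℝ) + c.sigR) y := by
      intro m _
      have hl := (lI_mem (c := c) m).2
      have h1 := vterm_taylor_lower hl habsy yc
      refine le_trans ?_ h1
      have hcabs : |yc| ≤ (yC.absHi : ℝ) / c.S := abs_le_absUp hS hyCm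
      have hfrac : (((m : ℝ) + c.sigR) ^ 2 + yc ^ 2 + 2 * |yc| * YM) /
            (((m : ℝ) + c.sigR) * (((m : ℝ) + c.sigR) ^ 2 + yc ^ 2) ^ 2) ≤
          (((m : ℝ) + c.sigR) ^ 2 + yc ^ 2 + 2 * ((yC.absHi : ℝ) / c.S) * YM) /
            (((m : ℝ) + c.sigR) * (((m : ℝ) + c.sigR) ^ 2 + yc ^ 2) ^ 2) := by
        gcongr
      nlinarith [sq_nonneg (y - yc)]
    have hs := Finset.sum_le_sum this
    refine le_trans (le_of_eq ?_) hs
    rw [Finset.sum_sub_distrib, Finset.sum_add_distrib, hyφ]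
    simp only [add_sub_cancel_left]
    rw [← Finset.sum_mul, ← Finset.mul_sum]
    ring
  have hRs : (φ * ρ) ^ 2 * Rs ≤ (EF.hi : ℝ) / c.S := by
    have hEFm : MI.mem c.S ((ρ * ηr) ^ 2 * Rs) EF := by
      rw [← hEFe]; exact MI.mem_mul hS (MI.mem_sqr hS hretam) hRsm
    refine le_trans ?_ (le_hi hS hEFm)
    have hRs0 : 0 ≤ Rs := by
      apply Finset.sum_nonneg; intro m _
      have hl := (lI_mem (c := c) m).2
      have : 0 ≤ (yC.absHi : ℝ) / c.S := le_trans (abs_nonneg _) (abs_le_absUp hS hyCm)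
      positivity
    have hφ2 : (φ * ρ) ^ 2 ≤ (ρ * ηr) ^ 2 := by
      rw [mul_pow, mul_pow, ← sq_abs φ]
      have : |φ| ^ 2 ≤ ηr ^ 2 := pow_le_pow_left₀ (abs_nonneg _) hφ 2
      nlinarith [sq_nonneg ρ]
    exact mul_le_mul_of_nonneg_right hφ2 hRs0
  -- assemble
  rw [re_digamma_eq_bracket_add c.sigR c.M0]
  have hBRlo : ((BR.lo : ℤ) : ℝ) = (((Dg.re.sub Ft).lo : ℤ) : ℝ) := by rw [← hBR]
  rw [hBRlo]
  linarith [hbr, hterms, hRs]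

/-- **The cell theorem.**  If `cellLo b ts E j = some (lo, loT)` (with `E` the block remainder), then
on the cell `θ ∈ [2πj/Mc, 2π(j+1)/Mc]` the full function is `≥ lo/S` and the periodic part `≥ loT/S`.
[folklore] -/
theorem cellLo_sound (hS : 0 < c.S) (hpi : MI.mem c.S Real.pi c.piI) {ρ : ℝ} (hρ : 0 < ρ)
    (hrho : MI.mem c.S ρ c.rhoI) {Cr : ℝ} (hC : MI.mem c.S Cr c.constI) (hR : 1 ≤ c.R)
    {b : DKBlock} (hMc : 1 ≤ b.Mc) (hden : 1 ≤ b.etaDen) (hnin : 1 ≤ b.nin) (hnum : 1 ≤ b.etaNum)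
    (heta : Real.pi / b.Mc ≤ (b.etaNum : ℝ) / b.etaDen) (htab : c.tabOK b = true)
    {ts : List GTerm} {rts : List RTerm} (hF : List.Forall₂ (GRepr c.S c.R) ts rts) (j : ℤ)
    {lo loT : ℤ} (h : c.cellLo b ts (c.remBlock (c.etaPow b) ts) j = some (lo, loT))
    {θ : ℝ} (hθ1 : 2 * π * j / b.Mc ≤ θ) (hθ2 : θ ≤ 2 * π * (j + 1) / b.Mc) :
    ((lo : ℝ) / c.S ≤ (Complex.digamma ((c.sigR : ℂ) + (ρ * θ : ℝ) * I)).re + Cr + sumVal rts θ) ∧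
      ((loT : ℝ) / c.S ≤ sumVal (cList ts rts) θ) := by
  have hSr : (0 : ℝ) < c.S := by exact_mod_cast hS
  have hMcr : (0 : ℝ) < b.Mc := by exact_mod_cast hMc
  set θc : ℝ := (2 * j + 1) * π / b.Mc with hθc
  set ηr : ℝ := (b.etaNum : ℝ) / b.etaDen with hηr
  have hη0 : 0 ≤ ηr := by rw [hηr]; positivity
  set φ : ℝ := θ - θc with hφ
  have hθφ : θ = θc + φ := by rw [hφ]; ring
  have hφabs : |φ| ≤ ηr := by
    refine le_trans ?_ heta
    rw [abs_le]; constructor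
    · rw [hφ, hθc]; have : 2 * π * j / b.Mc = (2 * j + 1) * π / b.Mc - π / b.Mc := by field_simp; ring
      linarith
    · rw [hφ, hθc]; have : 2 * π * (j + 1) / b.Mc = (2 * j + 1) * π / b.Mc + π / b.Mc := by
        field_simp; ring
      linarith
  -- unpack cellLo
  unfold cellLo at h
  cases hmom : c.moments b j ts with
  | none => simp [hmom] at h
  | some acc =>
  cases hdig : c.digammaData b j with
  | none => simp [hmom, hdig] at h
  | some dd =>
  obtain ⟨BR, F0, F1, EF⟩ := dd
  simp only [hmom, hdig, Option.some.injEq, Prod.mk.injEq] at h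
  obtain ⟨hlo, hloT⟩ := h
  -- the trig data
  obtain ⟨hmA, hmN⟩ := moments_mem hS hpi htab hMc j hF hmom
  have hmT := periodicMom_mem hF hmA hmN
  have hep := etaPow_mem hS hden (b := b)
  have hrem := remSum_le_remBlock_hi hS hη0 hep hF
  have htrig := sum_sub_remSum_le_sumVal θc hφabs c.R rts
  have htrigT := sum_sub_remSum_le_sumVal θc hφabs c.R (cList ts rts)
  have hremT := remSum_cList_le hη0 c.R ts rts
  rw [← hθφ] at htrig htrigT
  -- the digamma data
  obtain ⟨F0r, F1r, hF0m, hF1m, hBRth, hD⟩ := digammaData_sound hS hpi hρ hrho hMc hden j hdig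
  have hBRm : MI.mem c.S ((BR.lo : ℝ) / c.S) BR := by
    have := mem_thin hS BR.lo
    have e : (⟨BR.lo, BR.lo⟩ : MI) = BR := by
      cases BR with | mk lo hi => simp only at hBRth; simp [hBRth]
    rw [e] at this; exact this
  have hDθ := hD θ hθ1 hθ2 hφabs
  -- coefficient lists
  set cs := c.coeffs acc.1 with hcs
  have hlen : cs.length = 2 * c.R := coeffs_length _
  obtain ⟨c0, c1, rest, hsplit⟩ : ∃ c0 c1 rest, cs = c0 :: c1 :: rest := by
    match hh : cs, hlen with
    | [], hl => simp at hl; omega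
    | [_], hl => simp at hl; omega
    | c0 :: c1 :: rest, _ => exact ⟨c0, c1, rest, rfl⟩
  have hcm : CoefMem c (fun m ↦ coefSum rts θc m) cs := by
    intro m hm; rw [hlen] at hm; exact coeffs_mem hmA m hm
  set cr' : ℕ → ℝ := fun m ↦ coefSum rts θc m +
    (if m = 0 then (BR.lo : ℝ) / c.S + F0r + Cr else 0) + (if m = 1 then F1r else 0) with hcr'
  set cs' := (((c0.add BR).add F0).add c.constI) :: (c1.add F1) :: rest with hcs'
  have hcm' : CoefMem c cr' cs' := by
    intro m hm
    have hm2 : m < cs.length := by rw [hsplit]; rw [hcs'] at hm; simpa using hm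
    have hbase := hcm m hm2
    rw [hsplit] at hbase
    rcases m with _ | _ | m
    · have e : cr' 0 = coefSum rts θc 0 + ((BR.lo : ℝ) / c.S + F0r + Cr) := by simp [hcr']
      rw [e, hcs']
      simp only [List.getD_cons_zero] at hbase ⊢
      have := MI.mem_add (MI.mem_add (MI.mem_add hbase hBRm) hF0m) hC
      have e2 : coefSum rts θc 0 + ((BR.lo : ℝ) / c.S + F0r + Cr) =
          coefSum rts θc 0 + (BR.lo : ℝ) / c.S + F0r + Cr := by ring
      rw [e2]; exact this
    · have e : cr' 1 = coefSum rts θc 1 + F1r := by simp [hcr']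
      rw [e, hcs']
      simp only [List.getD_cons_succ, List.getD_cons_zero] at hbase ⊢
      exact MI.mem_add hbase hF1m
    · have e : cr' (m + 2) = coefSum rts θc (m + 2) := by simp [hcr']
      rw [e, hcs']
      simp only [List.getD_cons_succ] at hbase ⊢
      exact hbase
  have hlen' : cs'.length = 2 * c.R := by
    rw [hcs']; rw [hsplit] at hlen; simpa using hlen
  have hpoly := poly_ge_innerLo hS hden hnin hnum hcm' hφabs
  rw [hlen'] at hpoly
  -- the polynomial splits
  have hsplitpoly : polyR cr' (2 * c.R) φ =
      (∑ m ∈ range (2 * c.R), coefSum rts θc m * φ ^ m) + ((BR.lo : ℝ) / c.S + F0r + Cr) + F1r * φ := by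
    simp only [polyR, hcr', add_mul, Finset.sum_add_distrib, ite_mul, zero_mul]
    rw [Finset.sum_ite_eq' (range (2 * c.R)) 0, Finset.sum_ite_eq' (range (2 * c.R)) 1]
    simp only [Finset.mem_range, show 0 < 2 * c.R by omega, show 1 < 2 * c.R by omega, if_true,
      pow_zero, mul_one, pow_one]
  -- first conclusion
  have hE : remSum rts ηr c.R ≤ (((c.remBlock (c.etaPow b) ts).hi : ℤ) : ℝ) / c.S := hrem
  refine ⟨?_, ?_⟩
  · rw [hsplit] at hlo
    dsimp only at hlo
    have : ((lo : ℤ) : ℝ) / c.S = ((c.innerLo b cs' : ℤ) : ℝ) / c.S -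
        (((c.remBlock (c.etaPow b) ts).hi : ℤ) : ℝ) / c.S - ((EF.hi : ℤ) : ℝ) / c.S := by
      rw [← hlo, hcs']; push_cast; ring
    rw [this]
    linarith [hpoly, hsplitpoly, htrig, hDθ]
  · -- periodic part
    set csT := c.coeffs (c.periodicMom acc) with hcsT
    have hlenT : csT.length = 2 * c.R := coeffs_length _
    have hcmT : CoefMem c (fun m ↦ coefSum (cList ts rts) θc m) csT := by
      intro m hm; rw [hlenT] at hm; exact coeffs_mem hmT m hm
    have hpolyT := poly_ge_innerLo hS hden hnin hnum hcmT hφabs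
    rw [hlenT] at hpolyT
    have : ((loT : ℤ) : ℝ) / c.S = ((c.innerLo b csT : ℤ) : ℝ) / c.S -
        (((c.remBlock (c.etaPow b) ts).hi : ℤ) : ℝ) / c.S := by
      rw [← hloT, hcsT]; push_cast; ring
    rw [this]
    have hpr : polyR (fun m ↦ coefSum (cList ts rts) θc m) (2 * c.R) φ =
        ∑ m ∈ range (2 * c.R), coefSum (cList ts rts) θc m * φ ^ m := rfl
    linarith [hpolyT, htrigT, hremT]

end DKCert

end Summit.Ventures.WeilGRH

end
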